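import Summits.QuantumFields.YangMills.Theorems.IR.VacuumEscapeSpectralSeam
import Literature.MathematicalPhysics.QuantumFieldTheory.Balaban1983to89.MassGapFunctionalInequalities
import HarnessLib

/-!
# Line `vacuum_escape` (crux `BalabanLadder.IR`, stmt-QuantumFields-19354) — ordering of currencies:
# cold pressure in units ⇒ (gap face ∧ thermal face)

The per-`β` COLD-PRESSURE currency of the pincer lines (hypothesis `hcp` of the tree seam
`TensionRatio.gapInUnits_of_rate_in_units`, p589073; `ColdPressureBound r.ρ β S (κ·aβ) C₀` on all large tori: trace excesses
`x_{2S+1}(m+2) ≤ C₀ (2S+1)³ e^{−κ aβ (m+2)}` on the cold range `S + 1 ≤ 2(m+2)`) implies BOTH faces of line `vacuum_escape`: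
the gap face `SliceGapInUnits` (rate `κ`, the finitely many short times absorbed into the free constant `K(β,S)`) and the thermal
face `ColdPurity` (`K₀ = 1`, threshold `S₁(β)` where `C₀(β)(2S+1)³e^{−κ aβ (S+1)} ≤ 1`) — `faces_of_coldPressure`.  With
`spectralSeam_holds` (p616814) this RECOVERS `gapInUnits_of_rate_in_units` through the two faces, i.e. the cut
{`SliceGapInUnits`, `ColdPurity`} of line `vacuum_escape` is formally WEAKER (cheaper to supply) than the cold-pressure currency:
it never asks for trace excesses below the half height `S + 1`.  [folklore bookkeeping]

HONEST FRAMING: an ordering between typed currencies; proves no gap; `BalabanLadder.IR`, a lattice gap and the Yang–Mills mass gap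
(Clay) are untouched; R4 of the ladder closes only the conditional finite-𝕋⁴ rung `BalabanLadder.UV`.
-/

set_option autoImplicit false

noncomputable section

open scoped BigOperators
open Filter Topology MeasureTheory
open Literature.MathematicalPhysics.QuantumFieldTheory Literature.MathematicalPhysics.QuantumLattice
open Literature.MathematicalPhysics.QuantumFieldTheory.Balaban1983to89.Sufficient (ColdPressureBound)

namespace Summit.QuantumFields.YangMills.Cruxes.IR.VacuumEscape

variable {G : Type} [Group G] [TopologicalSpace G] [IsTopologicalGroup G] [CompactSpace G]
  [MeasurableSpace G] [BorelSpace G]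

/-- The volume factor dies along the cold diagonal: `C₀ (2S+1)³ e^{−g (S+1)} ≤ 1` for all large `S` (`g > 0`). [folklore] -/
theorem eventually_volume_mul_exp_le_one (C₀ : ℝ) {g : ℝ} (hg : 0 < g) :
    ∀ᶠ S : ℕ in atTop, C₀ * ((2 * S + 1 : ℕ) : ℝ) ^ 3 * Real.exp (-(g * ((S : ℝ) + 1))) ≤ 1 := by
  -- `u ↦ u³ e^{-u}` tends to `0`; `u = g (S+1)`
  have hu : Tendsto (fun S : ℕ => g * ((S : ℝ) + 1)) atTop atTop := by
    have h1 : Tendsto (fun S : ℕ => (S : ℝ) + 1) atTop atTop :=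
      tendsto_natCast_atTop_atTop.atTop_add tendsto_const_nhds
    exact h1.const_mul_atTop hg
  have h3 := (Real.tendsto_pow_mul_exp_neg_atTop_nhds_zero 3).comp hu
  have h4 : Tendsto (fun S : ℕ => |C₀| * (2 / g) ^ 3 * ((g * ((S : ℝ) + 1)) ^ 3 * Real.exp (-(g * ((S : ℝ) + 1)))))
      atTop (𝓝 (|C₀| * (2 / g) ^ 3 * 0)) := h3.const_mul _
  rw [mul_zero] at h4
  filter_upwards [h4.eventually (ge_mem_nhds one_pos)] with S hS
  have hcube : ((2 * S + 1 : ℕ) : ℝ) ^ 3 ≤ (2 / g) ^ 3 * (g * ((S : ℝ) + 1)) ^ 3 := by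
    rw [← mul_pow]
    refine pow_le_pow_left₀ (by positivity) ?_ 3
    have : 2 / g * (g * ((S : ℝ) + 1)) = 2 * ((S : ℝ) + 1) := by field_simp
    rw [this]; push_cast; linarith
  calc C₀ * ((2 * S + 1 : ℕ) : ℝ) ^ 3 * Real.exp (-(g * ((S : ℝ) + 1)))
      ≤ |C₀| * ((2 * S + 1 : ℕ) : ℝ) ^ 3 * Real.exp (-(g * ((S : ℝ) + 1))) := by
        gcongr; exact le_abs_self _
    _ ≤ |C₀| * ((2 / g) ^ 3 * (g * ((S : ℝ) + 1)) ^ 3) * Real.exp (-(g * ((S : ℝ) + 1))) := by gcongr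
    _ = |C₀| * (2 / g) ^ 3 * ((g * ((S : ℝ) + 1)) ^ 3 * Real.exp (-(g * ((S : ℝ) + 1)))) := by ring
    _ ≤ 1 := hS

/-- **Cold pressure on one torus ⇒ the gap-face datum**: a rate bound for ALL times `t ≥ 2` with a free constant (the short times
`2(m+2) < S+1` outside the cold range are finitely many and absorbed). [folklore] -/
theorem gapInput_of_coldPressureBound {N : ℕ} {ρ : G →* Matrix (Fin N) (Fin N) ℂ} {β : ℝ} {S : ℕ} {g C₀ : ℝ}
    (hC₀ : 0 ≤ C₀) (h : ColdPressureBound ρ β S g C₀) :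
    ∃ K : ℝ, ∀ m : ℕ, traceExcess ρ β (2 * S + 1) (m + 2) ≤ K * Real.exp (-(g * ((m + 2 : ℕ) : ℝ))) := by
  set K₂ : ℝ := ∑ m ∈ Finset.range S, |traceExcess ρ β (2 * S + 1) (m + 2)| * Real.exp (g * ((m + 2 : ℕ) : ℝ)) with hK₂
  have hK₂0 : 0 ≤ K₂ := Finset.sum_nonneg fun m _ => by positivity
  have hK₁0 : 0 ≤ C₀ * ((2 * S + 1 : ℕ) : ℝ) ^ 3 := by positivity
  refine ⟨C₀ * ((2 * S + 1 : ℕ) : ℝ) ^ 3 + K₂, fun m => ?_⟩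
  by_cases hm : S + 1 ≤ 2 * (m + 2)
  · exact (h m hm).trans (mul_le_mul_of_nonneg_right (le_add_of_nonneg_right hK₂0) (Real.exp_nonneg _))
  · have hmS : m ∈ Finset.range S := Finset.mem_range.2 (by omega)
    have hterm : |traceExcess ρ β (2 * S + 1) (m + 2)| * Real.exp (g * ((m + 2 : ℕ) : ℝ)) ≤ K₂ :=
      Finset.single_le_sum (f := fun m => |traceExcess ρ β (2 * S + 1) (m + 2)| * Real.exp (g * ((m + 2 : ℕ) : ℝ)))
        (fun m _ => by positivity) hmS
    calc traceExcess ρ β (2 * S + 1) (m + 2)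
        ≤ |traceExcess ρ β (2 * S + 1) (m + 2)| := le_abs_self _
      _ = |traceExcess ρ β (2 * S + 1) (m + 2)| * Real.exp (g * ((m + 2 : ℕ) : ℝ)) *
            Real.exp (-(g * ((m + 2 : ℕ) : ℝ))) := by
          rw [mul_assoc, ← Real.exp_add, add_neg_cancel, Real.exp_zero, mul_one]
      _ ≤ K₂ * Real.exp (-(g * ((m + 2 : ℕ) : ℝ))) := mul_le_mul_of_nonneg_right hterm (Real.exp_nonneg _)
      _ ≤ (C₀ * ((2 * S + 1 : ℕ) : ℝ) ^ 3 + K₂) * Real.exp (-(g * ((m + 2 : ℕ) : ℝ))) :=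
          mul_le_mul_of_nonneg_right (le_add_of_nonneg_left hK₁0) (Real.exp_nonneg _)

/-- **Cold pressure on one torus ⇒ the half-height multiplicity** `x(S+1) ≤ C₀ (2S+1)³ e^{−g(S+1)}` (`S ≥ 1`; the half height lies in
the cold range). [folklore] -/
theorem halfHeight_of_coldPressureBound {N : ℕ} {ρ : G →* Matrix (Fin N) (Fin N) ℂ} {β : ℝ} {S : ℕ} {g C₀ : ℝ}
    (hS : 1 ≤ S) (h : ColdPressureBound ρ β S g C₀) :
    traceExcess ρ β (2 * S + 1) (S + 1) ≤ C₀ * ((2 * S + 1 : ℕ) : ℝ) ^ 3 * Real.exp (-(g * ((S : ℝ) + 1))) := by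
  have h1 := h (S - 1) (by omega)
  have hcast : ((S - 1 + 2 : ℕ) : ℝ) = (S : ℝ) + 1 := by
    rw [show S - 1 + 2 = S + 1 by omega]; push_cast; ring
  rw [hcast] at h1
  rw [traceExcess_eq_of_eq ρ β (2 * S + 1) (show S + 1 = S - 1 + 2 by omega)]
  exact h1

/-- **Cold pressure in units ⇒ both faces of line `vacuum_escape`.**  The per-`β` cold-pressure currency at rate `κ·a(β)` on all large
tori (the hypothesis of `TensionRatio.gapInUnits_of_rate_in_units`) gives `SliceGapInUnits G r a` (rate `κ`) and `ColdPurity G r`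
(`K₀ = 1`).  Hence the cut {gap face, thermal face} is implied by — weaker than — cold pressure in units, and `spectralSeam_holds`
recovers the rate-in-units seam. [folklore] -/
theorem faces_of_coldPressure (r : LatticeRep G) (a : ℝ → ℝ) (ha : ∀ β, 0 < a β) {κ β₈ : ℝ} (hκ : 0 < κ)
    (hcp : ∀ β : ℝ, β₈ ≤ β → ∃ C₀ : ℝ, 0 ≤ C₀ ∧ ∃ S₃ : ℕ, ∀ S : ℕ, S₃ ≤ S → ColdPressureBound r.ρ β S (κ * a β) C₀) :
    SliceGapInUnits G r a ∧ ColdPurity G r := by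
  classical
  -- choose the data `C₀(β), S₃(β)` (junk below `β₈`)
  have hch : ∀ β : ℝ, ∃ C₀ : ℝ, ∃ S₃ : ℕ, β₈ ≤ β → 0 ≤ C₀ ∧ ∀ S : ℕ, S₃ ≤ S → ColdPressureBound r.ρ β S (κ * a β) C₀ := by
    intro β
    by_cases hβ : β₈ ≤ β
    · obtain ⟨C₀, hC₀, S₃, hS⟩ := hcp β hβ
      exact ⟨C₀, S₃, fun _ => ⟨hC₀, hS⟩⟩
    · exact ⟨0, 0, fun h => absurd h hβ⟩
  choose C₀ S₃ hdata using hch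
  -- the purity threshold: `C₀(β)(2S+1)³ e^{−κ aβ (S+1)} ≤ 1` for `S ≥ S₄(β)`
  have hS₄ : ∀ β : ℝ, ∃ S₄ : ℕ, ∀ S : ℕ, S₄ ≤ S →
      C₀ β * ((2 * S + 1 : ℕ) : ℝ) ^ 3 * Real.exp (-(κ * a β * ((S : ℝ) + 1))) ≤ 1 := fun β =>
    eventually_atTop.1 (eventually_volume_mul_exp_le_one (C₀ β) (mul_pos hκ (ha β)))
  choose S₄ hS₄ using hS₄
  refine ⟨⟨κ, β₈, S₃, hκ, fun β hβ S hS => ?_⟩, ⟨1, β₈, fun β => max (max (S₃ β) (S₄ β)) 1, fun β hβ S hS => ?_⟩⟩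
  · -- gap face
    obtain ⟨hC₀, hcold⟩ := hdata β hβ
    obtain ⟨K, hK⟩ := gapInput_of_coldPressureBound hC₀ (hcold S hS)
    refine ⟨K, fun t ht => ?_⟩
    obtain ⟨m, rfl⟩ : ∃ m, t = m + 2 := ⟨t - 2, by omega⟩
    exact hK m
  · -- thermal face
    obtain ⟨hC₀, hcold⟩ := hdata β hβ
    have hS3 : S₃ β ≤ S := le_trans (le_trans (le_max_left _ _) (le_max_left _ _)) hS
    have hS4 : S₄ β ≤ S := le_trans (le_trans (le_max_right _ _) (le_max_left _ _)) hS
    have hS1 : 1 ≤ S := le_trans (le_max_right _ _) hS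
    exact (halfHeight_of_coldPressureBound hS1 (hcold S hS3)).trans (hS₄ β S hS4)

end Summit.QuantumFields.YangMills.Cruxes.IR.VacuumEscape

end
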